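import Literature.NumberTheory.PAdicHodge.BmaxPlusLog
import Literature.RingTheory.FormalGroups.PadicLogTypeSeriesFrobenius
import Literature.RingTheory.FormalGroups.PadicLogTypeSeriesTeichmuller
import HarnessLib

/-!
# The `p`-adic log-series theorems in `A_max = B_max⁺(F)`: Frobenius annihilation and `φ·log[x] = p·log[x]`

Topic `Literature/NumberTheory/PAdicHodge`; namespace `Literature.NumberTheory.PAdicHodge`. THEOREMS ONLY (no definition, no named fact,
no instance, no `sorry`). The INSTANTIATION of the generic files `Literature/RingTheory/FormalGroups/PadicLogTypeSeries*.lean` (φ-road of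
line `kato_lever`, crux K★ `stmt-BirchSwinnertonDyer-22226`, memo `Lines/kato-lever-K2-phi-road.md`) at

  `B = B⁰_max = 𝔸_inf[ξ/p]` (`bmaxZero F p`, a domain of characteristic `0`: `isDomain_bmaxZero`, `charZero_bmaxZero`),
  `B^_(p) = A_max = BmaxPlus F p`, `ι = (𝔸_inf → B⁰_max) ∘ zpToAinf`, `φ = frobBmaxZero` (so `φ^ = frobBmaxPlus`,
  `adicCompletionMap_frobBmaxZero_eq`; `φ ∘ ι = ι`, `frobBmaxZero_comp_algebraMap_comp_zpToAinf`),

for `y = ι(y₀)`, `y₀ ∈ 𝔸_inf(F)` `(p, ξ)`-nilpotent (`y₀^N ∈ (p, ξ)` — every lift of an element of `𝔪_{ℂ_F}`,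
`exists_pow_mem_span_p_xi_of_norm_lt_one`; witness `y^N = p·z` by `exists_algebraMap_pow_eq_natCast_mul`), using that the Witt-vector
Frobenius is a Frobenius lift (`φ(y₀) − y₀ᵖ ∈ p𝔸_inf`):

* ★★★ `exists_evalₐ_frobBmaxPlus_honda_eq` — for `ℓ_b` of Honda type `p − aT + T²` (e.g. `log_V` of an elliptic curve with good reduction,
  `EllipticCurves.exists_natCast_mul_eq_honda_numerator`): `φ²Λ − ι(a)·φΛ + p·Λ ≡ 0 (mod p^{N+1})` at every level of `A_max`,
  `Λ = Λᵇ_N(y, z) = p^N · ℓ_b(y)`;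
* ★★★ `frobBmaxPlus_logSum_teichmuller_sub_one` — for `x ∈ 𝒪_{ℂ_F}♭` (with `x₀ = 1` so that a witness exists): `φ·Λ^{log}_N([x] − 1) = p·Λ^{log}_N([x] − 1)`,
  i.e. `p^N·log[x] ∈ (A_max)^{φ = p}` — the tree's `frobBmaxPlus_tBmax` (`φt = pt`) being the case `x = ε`.

(The raised heartbeat limits are for unification over the subalgebra `B⁰_max`, as in `BmaxPlusLog`.) Infrastructure only: BSD / K★ are not
proved by any of this.

## References
* T. Honda, *On the theory of commutative formal groups*, J. Math. Soc. Japan 22 (1970), Thm. 2 (p. 223), §6.2. [Honda1970]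
* P. Colmez, *Périodes p-adiques des variétés abéliennes*, Math. Ann. 292 (1992), §2. [Colmez1992PeriodesAbeliennes]
* J.-M. Fontaine, *Le corps des périodes p-adiques*, Astérisque 223 (1994), Exp. II §1.5.4. [FontaineAsterisque223III]
* J.-M. Fontaine, Y. Ouyang, *Theory of p-adic Galois representations*, §6.1. [FontaineOuyang2022]
-/

noncomputable section

namespace Literature.NumberTheory.PAdicHodge

open Literature.NumberTheory.GaloisRepresentations
open Literature.NumberTheory.GaloisRepresentations.IsNonarchimedeanLocalField
open Literature.RingTheory.FormalGroups WittVector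

variable {F : Type} [Field F] [ValuativeRel F] [TopologicalSpace F] [IsNonarchimedeanLocalField F]
  [CharZero F] {p : ℕ} [Fact p.Prime] [Fact (¬ IsUnit (p : integerC F))]
  [IsAdicComplete (Ideal.span {(p : integerC F)}) (integerC F)]

/-! ## The generic `p`-adic log-series theorems in `A_max = B_max⁺(F)`: `B = B⁰_max`, `ι = (𝔸_inf → B⁰_max) ∘ (ℤ_p → 𝔸_inf)`, `φ = frobBmaxZero` -/

omit [CharZero F] [IsAdicComplete (Ideal.span {(p : integerC F)}) (integerC F)] in
/-- `φ(zpToAinf c) = zpToAinf c` (local copy of `BmaxPlusLog.frobenius_zpToAinf`, kept private here). [folklore] -/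
private theorem frobenius_zpToAinf' (c : ℤ_[p]) : WittVector.frobenius (zpToAinf c : Ainf (p := p) F) = zpToAinf c := by
  unfold zpToAinf
  simp only [RingHom.coe_comp, Function.comp_apply]
  refine WittVector.ext fun n => ?_
  rw [WittVector.coeff_frobenius_charP, WittVector.map_coeff, ← map_pow, ZMod.pow_card]

omit [CharZero F] [IsAdicComplete (Ideal.span {(p : integerC F)}) (integerC F)] in
/-- `φ ∘ ι = ι` for `ι = (𝔸_inf → B⁰_max) ∘ zpToAinf` (local copy of `BmaxPlusLog.frobBmaxZero_comp_algebraMap_comp_zpToAinf`). [folklore] -/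
private theorem frobBmaxZero_comp_iota' :
    (frobBmaxZero F p).comp ((algebraMap (Ainf (p := p) F) (bmaxZero F p)).comp zpToAinf) =
      (algebraMap (Ainf (p := p) F) (bmaxZero F p)).comp zpToAinf := by
  refine RingHom.ext fun c => ?_
  simp only [RingHom.comp_apply]
  rw [frobBmaxZero_algebraMap, frobenius_zpToAinf']

set_option maxHeartbeats 3200000 in
/-- ★★★ **Frobenius annihilation in `A_max`.** Let `ℓ_b = Σ (b_m/m) Xᵐ` be of Honda type `p − aT + T²` (`m ∣ B_m`, hypothesis `he`; e.g.
the logarithm of an elliptic curve with good reduction, `EllipticCurves.exists_natCast_mul_eq_honda_numerator`), and let `y₀ ∈ 𝔸_inf(F)` be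
`(p, ξ)`-nilpotent (`y₀^N ∈ (p, ξ)`, e.g. any lift of an element of `𝔪_{ℂ_F}`, `exists_pow_mem_span_p_xi_of_norm_lt_one`) with witness
`y^N = p·z` in `B⁰_max` (`exists_algebraMap_pow_eq_natCast_mul`). Then for the `p`-adic sum `Λ = Λᵇ_N(y, z) ∈ A_max = B_max⁺(F)`
(`PadicLogSeries.logSum`): **`φ²Λ − ι(a)·φΛ + p·Λ ≡ p^{N+1}·w (mod pⁿ)` at every level `n`**, `φ = frobBmaxPlus` — the Witt-vector
Frobenius is a Frobenius lift (`φ(y₀) − y₀ᵖ ∈ p𝔸_inf`, cf. `exists_frobenius_eq_pow_add`) fixing `ℤ_p` (`BmaxPlusLog.frobBmaxZero_comp_algebraMap_comp_zpToAinf`, private copy here).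
[cite: Honda1970, Thm. 2 (p. 223) and §6.2] [cite: Colmez1992PeriodesAbeliennes, §2] -/
theorem exists_evalₐ_frobBmaxPlus_honda_eq (b : ℕ → ℤ_[p]) (a : ℤ_[p]) (e : ℕ → ℤ_[p])
    (he : ∀ m : ℕ, m ≠ 0 → (m : ℤ_[p]) * e m =
      b m - (if p ∣ m then a * b (m / p) else 0) + (if p ^ 2 ∣ m then (p : ℤ_[p]) * b (m / p ^ 2) else 0))
    {N : ℕ} (hN : 1 ≤ N) (y₀ : Ainf (p := p) F) {z : bmaxZero F p}
    (hz : algebraMap (Ainf (p := p) F) (bmaxZero F p) y₀ ^ N = (p : bmaxZero F p) * z) (n : ℕ) :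
    ∃ w : bmaxZero F p, AdicCompletion.evalₐ (Ideal.span {(p : bmaxZero F p)}) n
        (frobBmaxPlus F p (frobBmaxPlus F p
            (PadicLogSeries.logSum ((algebraMap (Ainf (p := p) F) (bmaxZero F p)).comp zpToAinf) b N
              (algebraMap (Ainf (p := p) F) (bmaxZero F p) y₀) z)) -
          AdicCompletion.of (Ideal.span {(p : bmaxZero F p)}) (bmaxZero F p)
              (((algebraMap (Ainf (p := p) F) (bmaxZero F p)).comp zpToAinf) a) *
            frobBmaxPlus F p
              (PadicLogSeries.logSum ((algebraMap (Ainf (p := p) F) (bmaxZero F p)).comp zpToAinf) b N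
                (algebraMap (Ainf (p := p) F) (bmaxZero F p) y₀) z) +
          AdicCompletion.of (Ideal.span {(p : bmaxZero F p)}) (bmaxZero F p) (p : bmaxZero F p) *
            PadicLogSeries.logSum ((algebraMap (Ainf (p := p) F) (bmaxZero F p)).comp zpToAinf) b N
              (algebraMap (Ainf (p := p) F) (bmaxZero F p) y₀) z) =
      Ideal.Quotient.mk _ ((p : bmaxZero F p) ^ (N + 1) * w) := by
  haveI := isDomain_bmaxZero (F := F) (p := p)
  haveI := charZero_bmaxZero (F := F) (p := p)
  have hmem : WittVector.frobenius y₀ - y₀ ^ p ∈ Ideal.span {(p : Ainf (p := p) F)} := by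
    rw [WittVector.mem_span_p_iff_coeff_zero_eq_zero, ← constantCoeff_apply, map_sub, map_pow, constantCoeff_apply,
      constantCoeff_apply, coeff_frobenius_charP, sub_self]
  obtain ⟨h₀, hh₀'⟩ := Ideal.mem_span_singleton'.1 hmem
  have hh₀ : WittVector.frobenius y₀ = y₀ ^ p + (p : Ainf (p := p) F) * h₀ := by rw [mul_comm, hh₀', add_sub_cancel]
  have hφy : frobBmaxZero F p (algebraMap (Ainf (p := p) F) (bmaxZero F p) y₀) =
      algebraMap (Ainf (p := p) F) (bmaxZero F p) y₀ ^ p + (p : bmaxZero F p) * algebraMap (Ainf (p := p) F) (bmaxZero F p) h₀ := by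
    rw [frobBmaxZero_algebraMap, hh₀, map_add, map_pow, map_mul, map_natCast]
  have h := PadicLogSeries.exists_evalₐ_frobenius_honda_eq ((algebraMap (Ainf (p := p) F) (bmaxZero F p)).comp zpToAinf) b
    (frobBmaxZero F p) frobBmaxZero_comp_iota' hN hz hφy a e he n
  exact h

set_option maxHeartbeats 3200000 in
/-- ★★★ **`φ·log[x] = p·log[x]` in `A_max`** (the `p^N`-normalised `p`-adic logarithm of a Teichmüller lift): for `x ∈ 𝒪_{ℂ_F}♭` with
`x₀ = 1` (so `y₀ = [x] − 1 ∈ (p, ξ)`-nilpotent, `teichmuller_sub_one_mem_span_p_xi_iff_coeff_zero`) and a witness `y^N = p·z` in `B⁰_max`,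
the sum `Λ = Λ^{log}_N([x] − 1, z) ∈ A_max` (numerators `(−1)^{m+1}`) satisfies **`φΛ = p·Λ`** — because `φ[x] = [x]ᵖ`
(`frobenius_teichmuller`) and `PadicLogSeries.adicCompletionMap_logSum_log_eq_of_frobenius`. The tree's `frobBmaxPlus_tBmax`
(`φt = pt`) is the case `x = ε`, `N = 1`. [cite: FontaineAsterisque223III, Exp. II §1.5.4] [cite: FontaineOuyang2022, §6.1] -/
theorem frobBmaxPlus_logSum_teichmuller_sub_one (x : PreTilt (integerC F) p) {N : ℕ} (hN : 1 ≤ N) {z : bmaxZero F p}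
    (hz : algebraMap (Ainf (p := p) F) (bmaxZero F p) ((teichmuller p x : Ainf (p := p) F) - 1) ^ N = (p : bmaxZero F p) * z) :
    frobBmaxPlus F p
        (PadicLogSeries.logSum ((algebraMap (Ainf (p := p) F) (bmaxZero F p)).comp zpToAinf)
          (fun m => if m = 0 then 0 else (-1) ^ (m + 1)) N
          (algebraMap (Ainf (p := p) F) (bmaxZero F p) ((teichmuller p x : Ainf (p := p) F) - 1)) z) =
      (p : BmaxPlus F p) *
        PadicLogSeries.logSum ((algebraMap (Ainf (p := p) F) (bmaxZero F p)).comp zpToAinf)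
          (fun m => if m = 0 then 0 else (-1) ^ (m + 1)) N
          (algebraMap (Ainf (p := p) F) (bmaxZero F p) ((teichmuller p x : Ainf (p := p) F) - 1)) z := by
  haveI := isDomain_bmaxZero (F := F) (p := p)
  haveI := charZero_bmaxZero (F := F) (p := p)
  have hφ : frobBmaxZero F p (1 + algebraMap (Ainf (p := p) F) (bmaxZero F p) ((teichmuller p x : Ainf (p := p) F) - 1)) =
      (1 + algebraMap (Ainf (p := p) F) (bmaxZero F p) ((teichmuller p x : Ainf (p := p) F) - 1)) ^ p := by
    rw [map_sub, map_one, add_sub_cancel, frobBmaxZero_algebraMap, frobenius_teichmuller, map_pow]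
  have h := PadicLogSeries.adicCompletionMap_logSum_log_eq_of_frobenius ((algebraMap (Ainf (p := p) F) (bmaxZero F p)).comp zpToAinf)
    (frobBmaxZero F p) frobBmaxZero_comp_iota' hN hz hφ
  exact h

end Literature.NumberTheory.PAdicHodge

end
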